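import Literature.MathematicalPhysics.QuantumFieldTheory.Balaban1983to89.B6Prop23MultiLevelTorus

/-!
# `Balaban1983to89.B6Ineq281MultiLevelTorus` — [B6] (2.70) AND (2.79)–(2.81) FOR THE GENUINE `k`-LEVEL OPERATOR
`G′ = Δ′_a⁻¹` ON THE TORUS `T_η`: the cube inverses `C_□ = ((Q′G′²Q′*)↾□)⁻¹` of print's FIRST prescription (p. 235) on
ARBITRARY finite sets of torus blocks `□ ⊂ 𝔅_T` lying on two adjacent levels — their support, the operator identity
`□·Q′G′²Q′*·□·C_□ = □` ((2.70)), and the decay (2.81) in print's distance (2.46) OF THE TORUS — the inputs `hCk0`, `h270`,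
`h281` of the cell's Proposition-2.3 assembly `B6Prop23TwoLevel.prop23_assembled_twoLevel` for the expansion (2.86) on `T_η`
(file E2 of the torus (2.86) programme of seat p21; torus twin of `B6Ineq281MultiLevelBox`; no existing module is touched;
no fact is minted)

FRAMING (verbatim cell line):
statement-level skeleton of published theorems with citation tags; proofs where landed; nothing here is a claim about the Yang–Mills mass gap

Source under audit (cell pub-balaban / lit-balaban): T. Bałaban, *Propagators and renormalization transformations for
lattice gauge theories. II*, Commun. Math. Phys. **96** (1984) 223–250 [`Balaban1984PropagatorsII`, "B6"], p. 235
[PDF 13] ((2.68)–(2.70)), p. 236 [PDF 14] ((2.71)–(2.78)), p. 237 [PDF 15] ((2.79)–(2.85)) — materialised text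
`paper:balaban1984-cmp96-propagators-rt-ii` p0013–p0016 re-read this generation; T. Bałaban, *Regularity and decay of
lattice Green's functions*, Commun. Math. Phys. **89** (1983) 571–597 [`Balaban1983RegularityDecay`, "[3]"], Sect. 5
(5.6)–(5.7) p. 594.  Unit `lit-balaban-p21` (Phase-2 proof seat p21 gen 17), HOME `run/shared/lean/pub/lit-balaban/`,
free-target protocol G.5-34(d), own lane (B6 fold owner r03, referee ref-4).

## WHAT IS PRINTED (pp. 235, 237, verbatim up to notation)

p. 235: «Now we will consider the operator (Q′G′²Q′*)⁻¹. … The approximate inverse can be constructed by taking inverses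
of the localized operators (Q′G′²Q′*)↾□ and glueing them together by the decomposition of unity {h_□}. We change this
prescription a little bit … C_□ = ((Q′G′(□̃)²Q′*)↾□)⁻¹, C = Σ_{□∈𝒟} h_□C_□h_□. (2.70)»  p. 237: «Of course we have also a
bound from above and an exponential decay of the kernel of Q′G′^ξ(□̃)²Q′* with the decay rate δ₀. Hence the operator
C^ξ_□ is bounded from above and below by absolute constants. We can use the theory developed in Sect. 5 [3] to conclude
that it has an exponential decay with a decay rate δ₁ depending on δ₀ and the bound γ₀. … Thus we have
|C^ξ_□(y, y′)| ≤ O(1)e^{−δ₁|y−y′|} (2.79) … C_□(y, y′) = (L^jη)^{−d−4}C^ξ_□((L^jη)^{−1}y, (L^jη)^{−1}y′), (2.80) hence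
|C_□(y, y′)| ≤ O(1)(L^jη)^{−d−4}e^{−δ₁(L^jη)^{−1}|y−y′|}, y, y′ ∈ 𝔅∩□. (2.81)»

## WHAT THIS FILE CERTIFIES (kernel-checked; setting of `B6MultiLevelTorusOperator` / `B8Ineq192MultiLevelTorus`)

For every nested family `D : TDomains d ℓ M_h k P R` of domains of the torus (levels `1 … k`, `Ω₁ = T_η`, lattice units,
spatial dimension `d + 1`, `L = ℓ + 1 ≥ 2`), windowed weights, the genuine torus `G′ = gmlT`, the (2.69)-kernel
`X = XkT` of `Q′G′²Q′*` and its conjugate `B = Λ⁻²W^{½}XW^{½}Λ⁻²` (`B6Prop23MultiLevelTorus.BmT`):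
* §1 [3] Sect. 5 FOR THE COMPRESSION `B↾□` to an ARBITRARY finite set of torus blocks `□`: (5.6) (`hyp56_BQT`: the
  coercivity of the compression is the GLOBAL level-weighted (2.78) of `B6QGGQCoerciveMultiLevelTorus` /
  `BmT_coercive` tested on extensions by zero — no two-level window is needed for it on the torus), invertibility of
  `B↾□` for EVERY member with NO threshold (`isUnit_BQT`, coercivity alone: «Of course the operator Q′G′²Q′* is positive
  definite»), and (5.7) `|(B↾□)⁻¹(y, y′)| ≤ 2C₄e^{−δ₁d_T(y,y′)}` (`invBQT_decay`, `B4Sect5Torus.inv_decay` over print's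
  distance (2.46) of the torus with the (2.61) profile `sumBound_torus`);
* §2 **THE CUBE INVERSE `C_□ = ((Q′G′²Q′*)↾□)⁻¹` ON THE TORUS** as a (2.69)-kernel extended by zero (`CkQT`): its support
  (`CkQT_off`, the binder `hCk0`), the contraction `W(y′)Σ_{y″∈□}W(y″)X(y,y″)C_□(y″,y′) = δ_{yy′}` (`sum_WXC_T`) and
  **(2.70) `□·Q′G′²Q′*·□·C_□ = □`** as operators on `ℝ^𝔅` (`loc_mul_CkQT`, the binder `h270` for print's first
  prescription `X̃_□ = X`), for every member with no threshold; and **(2.81)** on a two-level `□` (`CkQT_decay`);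
* §3 **`ineq281_multiLevelTorus`** — the package with thresholds explicit: `∃ δ₁, B_C, M₀, N₀ > 0` (functions of `d, L`,
  the weight window) such that for all `k`, `M_h ≥ 3` with `L·M_h ≥ M₀`, `R ≥ 2L` with `R·L·M_h ≥ N₀ + 1`, all periods
  `P_μ ≥ 4`, every `D`, windowed weights, and EVERY finite `□ ⊂ 𝔅_T` on two adjacent levels `j_s, j_s + 1`:
  (i) `C_□(y″, ·) = 0` off `□`; (ii) `□X□·C_□ = □`; (iii) `|C_□(y, y′)| ≤ B_C·(L^{j_s})^{−(d+1)−4}·e^{−δ₁d_T(y,y′)}` —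
  the exact shape of the Neumann-box twin `B6Ineq281MultiLevelBox.ineq281_multiLevelBox` with `d` ↦ `d_T`.

## HONEST SCOPE

Print's FIRST prescription `C_□ = ((Q′G′²Q′*)↾□)⁻¹` («taking inverses of the localized operators»), as in the box twin
(print's modification with `G′(□̃)` only serves print's proof of (2.81), obtained here for the first prescription
directly from [3] Sect. 5); the compression set `□` is ANY finite two-level set of torus blocks (the cover's enlarged cubes
`□⁺` of the companion `B6Cover236MultiLevelTorusBlocks` are the intended instances); print's carrier `T_η` with
`Ω₁ = T_η` (p. 224 «we admit the case when some domains Ω_j are equal to T_η»), `A = 0`, `m² = 0`, lattice units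
(`(L^jη)^{−d−4}` ↦ `(L^{j_s})^{−(d+1)−4}`), `P_μ ≥ 4` (the charts behind (2.67)₁ on `T_η`), `R ≥ 2L`; constants explicit
(`B_C = 2C₄L²`-type, `δ₁` the [3] Sect. 5 rate), `k`-uniform, not optimised.  Nothing is inferred from the manuscript:
every step is kernel-checked; the quoted sentences locate the statements.
-/

namespace Literature.MathematicalPhysics.QuantumFieldTheory.Balaban1983to89.B6Ineq281MultiLevelTorus

open Finset Matrix
open Literature.MathematicalPhysics.QuantumFieldTheory.Balaban1983to89.B4Reflection242 (boxDom)
open Literature.MathematicalPhysics.QuantumFieldTheory.Balaban1983to89.B6MultiLevelBoxOperator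
open Literature.MathematicalPhysics.QuantumFieldTheory.Balaban1983to89.B6MultiLevelTorusOperator (TDomains)
open Literature.MathematicalPhysics.QuantumFieldTheory.Balaban1983to89.B6Geom246MultiLevelBox
open Literature.MathematicalPhysics.QuantumFieldTheory.Balaban1983to89.B6Geom246MultiLevelTorus
open Literature.MathematicalPhysics.QuantumFieldTheory.Balaban1983to89.B6Ineq268MultiLevelBox (W W_pos W_eq)
open Literature.MathematicalPhysics.QuantumFieldTheory.Balaban1983to89.B8Ineq192MultiLevelTorus (geomTB geomTB_dist
  geomTB_len geomT_len geomTB_L geomTB_eta geomTB_M geomTB_R geomTB_RM geomTB_RM_nonneg triangleTB symmTB symmT levelSepTB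
  XkT kerOp_XkT lenT_pos lenT_eq)
open Literature.MathematicalPhysics.QuantumFieldTheory.Balaban1983to89.B6QGQCoerciveMultiLevelBox (nb one_le_nb nb_cast
  W_eq_nb_pow)
open Literature.MathematicalPhysics.QuantumFieldTheory.Balaban1983to89.B6QGGQCoerciveMultiLevelTorus (C4 C4_pos)
open Literature.MathematicalPhysics.QuantumFieldTheory.Balaban1983to89.B6Ineq268MultiLevelTorus (ineq268_multiLevelTorus)
open Literature.MathematicalPhysics.QuantumFieldTheory.Balaban1983to89.B6Ineq281MultiLevelBox (mW cw lgap Kprof rate_Kprof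
  hyp56_submatrix_window indQ cwW_mul_le)
open Literature.MathematicalPhysics.QuantumFieldTheory.Balaban1983to89.B6Prop23MultiLevelTorus (BmT BmT_isSymm BmT_form
  BmT_coercive BmT_entry_le isPseudoDist_distT sumBound_torus)
open Literature.MathematicalPhysics.QuantumFieldTheory.Balaban1983to89.B6Ineq243TwoLevelBox (aNext)
open Literature.MathematicalPhysics.QuantumFieldTheory.Balaban1983to89.B6Expansion282 (kerOp mulOp kerOp_apply
  mulOp_apply)
open Literature.MathematicalPhysics.QuantumFieldTheory.Balaban1983to89.B6Prop23Chain (mat mat_kerOp)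
open Literature.MathematicalPhysics.QuantumFieldTheory.Balaban1983to89.B4Sect5Torus (IsPseudoDist SumBound Hyp56
  rate inv_decay isUnit_of_hyp56 rate_pos)
open Literature.MathematicalPhysics.QuantumFieldTheory.Balaban1983to89.B6Ineq261LevelGap (K261 K261_nonneg
  theta_lt_one_of_log)
open Literature.MathematicalPhysics.QuantumFieldTheory.Balaban1983to89.B6Lemma21Repaired (Ineq261With)

noncomputable section

variable {d : ℕ}

/-! ## §1 [3] Sect. 5, (5.6) ⇒ (5.7), for the compression of `B` to a finite set of torus blocks -/

section Sect5

variable {ℓ Mh k R : ℕ} {P : Fin (d + 1) → ℕ} (D : TDomains d ℓ Mh k P R) (a : ℕ → ℝ)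

/-- `m(y) > 0`. [folklore] -/
private theorem mW_pos (y : ↥(bset D.toDomains)) : 0 < mW D.toDomains y := Real.sqrt_pos.2 (W_pos D.toDomains y)

/-- `n(y) > 0` as a real. [folklore] -/
private theorem nbR_pos (y : ↥(bset D.toDomains)) : (0 : ℝ) < ((nb D.toDomains y : ℕ) : ℝ) := by
  exact_mod_cast one_le_nb D.toDomains y

/-- `c(y) > 0`. [folklore] -/
private theorem cw_pos (y : ↥(bset D.toDomains)) : 0 < cw D.toDomains y :=
  div_pos (mW_pos D y) (pow_pos (nbR_pos D y) 2)

/-- the compression of `B` to a finite set of torus blocks `Q` («(·)↾□, 𝔅 ∩ □»). [cite: Balaban1984PropagatorsII, (2.70) p.235] -/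
abbrev BQT (Q : Finset ↥(bset D.toDomains)) : Matrix ↥Q ↥Q ℝ :=
  (BmT D a).submatrix (fun i : ↥Q => i.1) (fun i : ↥Q => i.1)

/-- **(5.6) FOR `B↾Q` ON THE TORUS**, `Q` ARBITRARY: symmetric, coercive with `γ_B = C₄⁻¹` (the GLOBAL (2.78) of the
torus tested on extensions by zero), entries `≤ CL^{d+3}e^{−(δ₀/8)d_T}`.
[cite: Balaban1983RegularityDecay, (5.6) p.594; Balaban1984PropagatorsII, (2.78)–(2.79) p.236–237] -/
theorem hyp56_BQT (hℓ : 1 ≤ ℓ) (hMh : 1 ≤ Mh) (hP : ∀ μ, 1 ≤ P μ) (hRM : 1 ≤ R * ((ℓ + 1) * Mh)) {aplus : ℝ}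
    (ha : ∀ j, 1 ≤ j → 0 < a j) (hale : ∀ j, 1 ≤ j → a j ≤ aplus) {C δ₀ : ℝ} (hC : 0 ≤ C) (hδ₀ : 0 ≤ δ₀)
    (hX : ∀ y y', |XkT D a y y'| ≤ C * (geomT D).len y ^ 4 * ((geomT D).len y' ^ (d + 1))⁻¹ *
      Real.exp (-(δ₀ / 4 * (geomT D).dist y y')))
    (hsmall : ((ℓ : ℝ) + 1) ^ (d + 3) * Real.exp (-(δ₀ / 8 * ((R : ℝ) * (((ℓ : ℝ) + 1) * Mh) - 1))) ≤ 1)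
    (Q : Finset ↥(bset D.toDomains)) :
    Hyp56 (fun i j : ↥Q => (geomT D).dist i.1 j.1) (BQT D a Q) (C4 d aplus)⁻¹
      (C * ((ℓ : ℝ) + 1) ^ (d + 3)) (δ₀ / 8) := by
  refine hyp56_submatrix_window (ρ := fun y y' : ↥(bset D.toDomains) => (geomT D).dist y y') (BmT_isSymm D a)
    (BmT_entry_le D a hℓ hMh hP hRM hC hδ₀ hX hsmall) Q ?_
  intro w _
  have h := BmT_coercive D a hℓ hMh hP ha hale w
  unfold dotProduct at h
  exact h

/-- **`B↾Q` IS INVERTIBLE — for every member and every `Q`, no threshold** (coercivity alone: «Of course the operator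
Q′G′²Q′* is positive definite, so its inverse is well defined»; a compression of a positive definite form is positive
definite). [cite: Balaban1984PropagatorsII, p.235 (before (2.70))] -/
theorem isUnit_BQT (hℓ : 1 ≤ ℓ) (hMh : 1 ≤ Mh) (hP : ∀ μ, 1 ≤ P μ) {aplus : ℝ} (ha : ∀ j, 1 ≤ j → 0 < a j)
    (hale : ∀ j, 1 ≤ j → a j ≤ aplus) (Q : Finset ↥(bset D.toDomains)) : IsUnit (BQT D a Q) := by
  classical
  refine QGQInverse.isUnit_of_coercive (inv_pos.2 (C4_pos d aplus)) fun v => ?_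
  -- test the global coercivity on the extension of `v` by zero
  have he : Function.Injective (fun i : ↥Q => (i.1 : ↥(bset D.toDomains))) := Subtype.val_injective
  obtain ⟨w, hw⟩ : ∃ w : ↥(bset D.toDomains) → ℝ, w = Function.extend (fun i : ↥Q => (i.1 : ↥(bset D.toDomains))) v 0 :=
    ⟨_, rfl⟩
  have hwe : ∀ i : ↥Q, w i.1 = v i := fun i => by rw [hw]; exact he.extend_apply _ _ _
  have hw0 : ∀ p, (¬ ∃ i : ↥Q, (i.1 : ↥(bset D.toDomains)) = p) → w p = 0 := fun p hp => by
    rw [hw, Function.extend_apply' _ _ _ hp, Pi.zero_apply]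
  have h := BmT_coercive D a hℓ hMh hP ha hale w
  have e1 : ∑ p, w p ^ 2 = v ⬝ᵥ v := by
    rw [B4Sect5Torus.sum_eq_sum_range he (fun p => w p ^ 2) (fun p hp => by rw [hw0 p hp]; ring)]
    simp only [hwe, dotProduct, pow_two]
  have e2 : ∀ p, (BmT D a).mulVec w p = ∑ j : ↥Q, BmT D a p j.1 * v j := by
    intro p
    simp only [Matrix.mulVec, dotProduct]
    rw [B4Sect5Torus.sum_eq_sum_range he (fun q => BmT D a p q * w q) (fun q hq => by rw [hw0 q hq, mul_zero])]
    simp only [hwe]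
  have e3 : w ⬝ᵥ (BmT D a).mulVec w = v ⬝ᵥ (BQT D a Q).mulVec v := by
    unfold dotProduct
    rw [B4Sect5Torus.sum_eq_sum_range he (fun p => w p * (BmT D a).mulVec w p)
      (fun p hp => by rw [hw0 p hp, zero_mul])]
    refine Finset.sum_congr rfl fun i _ => ?_
    rw [hwe, e2]
    simp [Matrix.mulVec, dotProduct, Matrix.submatrix_apply]
  rw [← e1, ← e3]
  exact h

/-- **(5.7) FOR `B↾Q` ON THE TORUS** («the theory developed in Sect. 5 [3]»): `|(B↾Q)⁻¹(y, y′)| ≤ 2C₄e^{−δ₁d_T(y,y′)}`,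
`δ₁ = rate(K, C₄⁻¹, CL^{d+3}, δ₀/8)`. [cite: Balaban1984PropagatorsII, (2.79) p.237; Balaban1983RegularityDecay, (5.7) p.594] -/
theorem invBQT_decay (hℓ : 1 ≤ ℓ) (hMh : 1 ≤ Mh) (hP : ∀ μ, 1 ≤ P μ) (hRM : 1 ≤ R * ((ℓ + 1) * Mh)) {aplus : ℝ}
    (ha : ∀ j, 1 ≤ j → 0 < a j) (hale : ∀ j, 1 ≤ j → a j ≤ aplus) {C δ₀ c16 : ℝ} (hC : 0 ≤ C) (hδ₀ : 0 < δ₀)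
    (hc16 : 0 ≤ c16)
    (hX : ∀ y y', |XkT D a y y'| ≤ C * (geomT D).len y ^ 4 * ((geomT D).len y' ^ (d + 1))⁻¹ *
      Real.exp (-(δ₀ / 4 * (geomT D).dist y y')))
    (hsmall : ((ℓ : ℝ) + 1) ^ (d + 3) * Real.exp (-(δ₀ / 8 * ((R : ℝ) * (((ℓ : ℝ) + 1) * Mh) - 1))) ≤ 1)
    (h261 : Ineq261With c16 (geomT D) δ₀ (1 / 16))
    (Q : Finset ↥(bset D.toDomains)) (i j : ↥Q) :
    |(BQT D a Q)⁻¹ i j| ≤ 2 / (C4 d aplus)⁻¹ *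
      Real.exp (-(rate (Kprof δ₀ c16 (Fintype.card ↥(bset D.toDomains))) (C4 d aplus)⁻¹
        (C * ((ℓ : ℝ) + 1) ^ (d + 3)) (δ₀ / 8) * (geomT D).dist i.1 j.1)) :=
  inv_decay (fun t _ => by unfold Kprof; split_ifs; exacts [hc16, Nat.cast_nonneg _]) (inv_pos.2 (C4_pos d aplus))
    (by positivity) (by positivity) ((isPseudoDist_distT D hMh hP).comp fun i : ↥Q => i.1)
    ((sumBound_torus D hMh hP h261).comp Subtype.val_injective)
    (hyp56_BQT D a hℓ hMh hP hRM ha hale hC hδ₀.le hX hsmall Q) i j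

end Sect5

/-! ## §2 The cube inverse `C_□` (2.70) on the torus: support, the identity `□X□·C_□ = □`, the decay (2.81) -/

section Cube

variable {ℓ Mh k R : ℕ} {P : Fin (d + 1) → ℕ} (D : TDomains d ℓ Mh k P R) (a : ℕ → ℝ)
  (Q : Finset ↥(bset D.toDomains))

/-- `(B↾Q)⁻¹` extended by zero to `𝔅_T × 𝔅_T`. [cite: Balaban1984PropagatorsII, (2.70) p.235] -/
def BinvT : Matrix ↥(bset D.toDomains) ↥(bset D.toDomains) ℝ := fun y y' =>
  if h : y ∈ Q ∧ y' ∈ Q then (BQT D a Q)⁻¹ ⟨y, h.1⟩ ⟨y', h.2⟩ else 0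

/-- **THE CUBE INVERSE `C_□ = ((Q′G′²Q′*)↾□)⁻¹` ON THE TORUS AS A (2.69)-KERNEL** (extended by zero off `□ × □`):
`C_□(y, y′) = (c(y)/W(y))·(B↾Q)⁻¹(y, y′)·(c(y′)/W(y′))` — the conjugation undone. [cite: Balaban1984PropagatorsII, (2.70) p.235, (2.80) p.237] -/
def CkQT : ↥(bset D.toDomains) → ↥(bset D.toDomains) → ℝ := fun y y' =>
  cw D.toDomains y / W D.toDomains y * BinvT D a Q y y' * (cw D.toDomains y' / W D.toDomains y')

variable {D a Q}

/-- entries of `BinvT` on `Q × Q`. [folklore] -/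
private theorem BinvT_of_mem {y y' : ↥(bset D.toDomains)} (hy : y ∈ Q) (hy' : y' ∈ Q) :
    BinvT D a Q y y' = (BQT D a Q)⁻¹ ⟨y, hy⟩ ⟨y', hy'⟩ := by
  unfold BinvT; rw [dif_pos ⟨hy, hy'⟩]

/-- `BinvT` vanishes off `Q × Q`. [folklore] -/
private theorem BinvT_of_not {y y' : ↥(bset D.toDomains)} (h : y ∉ Q ∨ y' ∉ Q) : BinvT D a Q y y' = 0 := by
  unfold BinvT
  rw [dif_neg]
  rintro ⟨h1, h2⟩
  rcases h with h | h
  · exact h h1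
  · exact h h2

/-- **`C_□` LIVES ON `□`**: `C_□(y″, y′) = 0` for `y″ ∉ □` (the binder `hCk0`) — and for `y′ ∉ □`.
[cite: Balaban1984PropagatorsII, (2.70) p.235] -/
theorem CkQT_off {y'' y' : ↥(bset D.toDomains)} (h : y'' ∉ Q ∨ y' ∉ Q) : CkQT D a Q y'' y' = 0 := by
  unfold CkQT; rw [BinvT_of_not h, mul_zero, zero_mul]

/-- `X(y, y″) = B(y, y″)/(c(y)c(y″))`. [folklore] -/
private theorem XkT_eq_BmT (y y'' : ↥(bset D.toDomains)) :
    XkT D a y y'' = BmT D a y y'' / (cw D.toDomains y * cw D.toDomains y'') := by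
  unfold BmT
  have h1 := (cw_pos D y).ne'
  have h2 := (cw_pos D y'').ne'
  field_simp

variable (D a Q)

/-- the key contraction: for `y, y′ ∈ □`, `W(y′)·Σ_{y″∈□} W(y″)X(y, y″)C_□(y″, y′) = δ_{yy′}` (it is `(B↾Q)(B↾Q)⁻¹ = 1`
conjugated). [cite: Balaban1984PropagatorsII, (2.70) p.235] -/
theorem sum_WXC_T {y y' : ↥(bset D.toDomains)} (hy : y ∈ Q) (hy' : y' ∈ Q) (hU : IsUnit (BQT D a Q)) :
    W D.toDomains y' * ∑ y'', indQ D.toDomains Q y'' * (W D.toDomains y'' * XkT D a y y'' * CkQT D a Q y'' y') =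
      if y = y' then 1 else 0 := by
  classical
  have he : Function.Injective (fun i : ↥Q => (i.1 : ↥(bset D.toDomains))) := Subtype.val_injective
  have hoff : ∀ p : ↥(bset D.toDomains), (¬ ∃ i : ↥Q, (i.1 : ↥(bset D.toDomains)) = p) →
      indQ D.toDomains Q p * (W D.toDomains p * XkT D a y p * CkQT D a Q p y') = 0 := by
    intro p hp
    have hpQ : p ∉ Q := fun h => hp ⟨⟨p, h⟩, rfl⟩
    unfold indQ; rw [if_neg hpQ, zero_mul]
  rw [B4Sect5Torus.sum_eq_sum_range he _ hoff]
  have hterm : ∀ q : ↥Q, indQ D.toDomains Q q.1 * (W D.toDomains q.1 * XkT D a y q.1 * CkQT D a Q q.1 y')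
      = (BQT D a Q ⟨y, hy⟩ q * (BQT D a Q)⁻¹ q ⟨y', hy'⟩) *
        (cw D.toDomains y' / (cw D.toDomains y * W D.toDomains y')) := by
    intro q
    unfold indQ CkQT
    rw [if_pos q.2, one_mul, XkT_eq_BmT, BinvT_of_mem q.2 hy']
    have h1 := (cw_pos D y).ne'
    have h2 := (cw_pos D q.1).ne'
    have h3 := (W_pos D.toDomains q.1).ne'
    have h4 := (W_pos D.toDomains y').ne'
    simp only [Matrix.submatrix_apply]
    field_simp
  rw [Finset.sum_congr rfl fun q _ => hterm q, ← Finset.sum_mul, ← Matrix.mul_apply,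
    Matrix.mul_nonsing_inv _ ((Matrix.isUnit_iff_isUnit_det _).mp hU), Matrix.one_apply]
  have h1 := (cw_pos D y').ne'
  have h4 := (W_pos D.toDomains y').ne'
  by_cases hyy : y = y'
  · subst hyy
    rw [if_pos rfl, if_pos rfl]
    field_simp
  · rw [if_neg (fun h => hyy (congrArg Subtype.val h)), if_neg hyy]; ring

/-- **THE OPERATOR IDENTITY `□·Q′G′²Q′*·□·C_□ = □` ON `ℝ^{𝔅_T}`** (pairing (2.69); with `□h_□ = h_□` it gives
`(□X̃_□□)C_□h_□ = h_□`, the input `h270` of the Prop. 2.3 assembly for the first prescription `X̃_□ = X`).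
[cite: Balaban1984PropagatorsII, (2.70) p.235, (2.82) p.237] -/
theorem loc_mul_CkQT (hU : IsUnit (BQT D a Q)) :
    mulOp (indQ D.toDomains Q) * kerOp (W D.toDomains) (XkT D a) * mulOp (indQ D.toDomains Q) *
        kerOp (W D.toDomains) (CkQT D a Q) = mulOp (indQ D.toDomains Q) := by
  classical
  refine LinearMap.ext fun μ => funext fun y => ?_
  simp only [Module.End.mul_apply, mulOp_apply, kerOp_apply]
  by_cases hy : y ∈ Q
  swap
  · unfold indQ; rw [if_neg hy, zero_mul, zero_mul]
  have hre : ∑ y'', W D.toDomains y'' * XkT D a y y'' *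
        (indQ D.toDomains Q y'' * ∑ y', W D.toDomains y' * CkQT D a Q y'' y' * μ y')
      = ∑ y', μ y' * (W D.toDomains y' *
        ∑ y'', indQ D.toDomains Q y'' * (W D.toDomains y'' * XkT D a y y'' * CkQT D a Q y'' y')) := by
    simp only [Finset.mul_sum]
    rw [Finset.sum_comm]
    exact Finset.sum_congr rfl fun y' _ => Finset.sum_congr rfl fun y'' _ => by ring
  rw [hre]
  have hval : ∀ y', μ y' * (W D.toDomains y' *
        ∑ y'', indQ D.toDomains Q y'' * (W D.toDomains y'' * XkT D a y y'' * CkQT D a Q y'' y'))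
      = if y = y' then μ y' else 0 := by
    intro y'
    by_cases hy' : y' ∈ Q
    · rw [sum_WXC_T D a Q hy hy' hU]; split_ifs <;> simp
    · have h0 : ∀ y'', CkQT D a Q y'' y' = 0 := fun y'' => CkQT_off (Or.inr hy')
      simp only [h0, mul_zero, Finset.sum_const_zero]
      rw [if_neg (fun h : y = y' => hy' (h ▸ hy))]
  rw [Finset.sum_congr rfl fun y' _ => hval y', Finset.sum_ite_eq]
  unfold indQ; rw [if_pos (Finset.mem_univ y), if_pos hy, one_mul]

/-- **[B6] (2.81) FOR THE GENUINE `k`-LEVEL OPERATOR ON THE TORUS**: on a two-level set of blocks `□` (levels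
`j_s, j_s + 1`), `|C_□(y, y′)| ≤ 2C₄L²·(L^{j_s})^{−(d+1)−4}·e^{−δ₁d_T(y,y′)}` — «|C_□(y, y′)| ≤ O(1)(L^jη)^{−d−4}
e^{−δ₁(L^jη)^{−1}|y−y′|}» with print's `d` the spatial dimension (`d + 1` here) and `d_T` print's distance (2.46) of the
torus (inside one cube the straight contour is admissible in (2.46), so the `d_T`-form is the weaker statement).
[cite: Balaban1984PropagatorsII, (2.81) p.237, (2.79)–(2.80) p.237] -/
theorem CkQT_decay (hℓ : 1 ≤ ℓ) (hMh : 1 ≤ Mh) (hP : ∀ μ, 1 ≤ P μ) (hRM : 1 ≤ R * ((ℓ + 1) * Mh)) {aplus : ℝ}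
    (ha : ∀ j, 1 ≤ j → 0 < a j) (hale : ∀ j, 1 ≤ j → a j ≤ aplus) {C δ₀ c16 : ℝ} (hC : 0 ≤ C) (hδ₀ : 0 < δ₀)
    (hc16 : 0 ≤ c16)
    (hX : ∀ y y', |XkT D a y y'| ≤ C * (geomT D).len y ^ 4 * ((geomT D).len y' ^ (d + 1))⁻¹ *
      Real.exp (-(δ₀ / 4 * (geomT D).dist y y')))
    (hsmall : ((ℓ : ℝ) + 1) ^ (d + 3) * Real.exp (-(δ₀ / 8 * ((R : ℝ) * (((ℓ : ℝ) + 1) * Mh) - 1))) ≤ 1)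
    (h261 : Ineq261With c16 (geomT D) δ₀ (1 / 16))
    (js : ℕ) (hQ : ∀ y ∈ Q, js ≤ y.1.1 ∧ y.1.1 ≤ js + 1) {y y' : ↥(bset D.toDomains)} (hy : y ∈ Q) (hy' : y' ∈ Q) :
    |CkQT D a Q y y'| ≤ 2 / (C4 d aplus)⁻¹ / (((ℓ : ℝ) + 1) ^ js * 1) ^ (d + 1 + 4) *
      Real.exp (-(rate (Kprof δ₀ c16 (Fintype.card ↥(bset D.toDomains))) (C4 d aplus)⁻¹
        (C * ((ℓ : ℝ) + 1) ^ (d + 3)) (δ₀ / 8) * (geomT D).dist y y')) := by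
  have hinv := invBQT_decay D a hℓ hMh hP hRM ha hale hC hδ₀ hc16 hX hsmall h261 Q ⟨y, hy⟩ ⟨y', hy'⟩
  have hwt := cwW_mul_le D.toDomains hℓ (hQ y hy).1 (hQ y' hy').1
  unfold CkQT
  rw [BinvT_of_mem hy hy', mul_one]
  have e : cw D.toDomains y / W D.toDomains y * (BQT D a Q)⁻¹ ⟨y, hy⟩ ⟨y', hy'⟩ * (cw D.toDomains y' / W D.toDomains y') =
      (cw D.toDomains y / W D.toDomains y * (cw D.toDomains y' / W D.toDomains y')) * (BQT D a Q)⁻¹ ⟨y, hy⟩ ⟨y', hy'⟩ := by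
    ring
  rw [e, abs_mul, abs_of_pos (mul_pos (div_pos (cw_pos D y) (W_pos D.toDomains y))
    (div_pos (cw_pos D y') (W_pos D.toDomains y')))]
  have hγ : 0 ≤ 2 / (C4 d aplus)⁻¹ := by have := C4_pos d aplus; positivity
  calc cw D.toDomains y / W D.toDomains y * (cw D.toDomains y' / W D.toDomains y') * |(BQT D a Q)⁻¹ ⟨y, hy⟩ ⟨y', hy'⟩|
      ≤ ((((ℓ : ℝ) + 1) ^ js) ^ (d + 1 + 4))⁻¹ * (2 / (C4 d aplus)⁻¹ *
          Real.exp (-(rate (Kprof δ₀ c16 (Fintype.card ↥(bset D.toDomains))) (C4 d aplus)⁻¹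
            (C * ((ℓ : ℝ) + 1) ^ (d + 3)) (δ₀ / 8) * (geomT D).dist y y'))) :=
        mul_le_mul hwt hinv (abs_nonneg _) (by positivity)
    _ = _ := by ring

end Cube

/-! ## §3 The package over the `k`-level torus family, thresholds explicit -/

section Package

/-- **[B6] (2.70) + (2.81) FOR THE GENUINE `k`-LEVEL OPERATOR ON THE TORUS `T_η` — THE CUBE INVERSES OF PRINT'S FIRST
PRESCRIPTION, UNIFORMLY.**  There are `δ₁, B_C, M₀, N₀ > 0` (functions of `d`, `L` and the weight window) such that for
every number of levels `k`, `M_h ≥ 3` with `L·M_h ≥ M₀`, `R ≥ 2L` with `R·L·M_h ≥ N₀ + 1`, all periods `P_μ ≥ 4`, every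
nested family `D` of domains of the torus ((2.1)–(2.2), `Ω₁ = T_η`), every windowed weight sequence, and EVERY finite set
of torus blocks `□ ⊂ 𝔅_T` lying on two adjacent levels `j_s, j_s + 1` («either □̃ ⊂ B^j(Λ_j), or it intersects
B^{j+1}(Λ_{j+1}) also»), the kernel `C_□ = CkQT` satisfies: (i) `C_□(y″, ·) = 0` for `y″ ∉ □`; (ii)
`□·Q′G′²Q′*·□·C_□ = □` (so `C_□ = ((Q′G′²Q′*)↾□)⁻¹`, (2.70)); (iii) **(2.81)** `|C_□(y, y′)| ≤ B_C·(L^{j_s})^{−(d+1)−4}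
·e^{−δ₁d_T(y,y′)}`, `y, y′ ∈ □`, `d_T` print's distance (2.46) of the torus — the inputs `hCk0`, `h270`, `h281` of
`B6Prop23TwoLevel.prop23_assembled_twoLevel` on `T_η`.  Route: (2.68)_T (`ineq268_multiLevelTorus`) + the GLOBAL (2.78)_T
(`BmT_coercive`) ⇒ [3] (5.6) for the conjugated compressed kernel ⇒ (5.7) (`B4Sect5Torus.inv_decay`, profile = Lemma 2.1
on the torus at `α = 1/16`) ⇒ (2.80)–(2.81).
[cite: Balaban1984PropagatorsII, (2.70) p.235, (2.78)–(2.81) p.236–237, p.224 (Ω_j = T_η admitted); Balaban1983RegularityDecay, Sect. 5 (5.6)–(5.7) p.594] -/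
theorem ineq281_multiLevelTorus (d ℓ : ℕ) (hℓ : 1 ≤ ℓ) (aminus aplus a2minus a2plus : ℝ) (ha : 0 < aminus)
    (ha2 : 0 < a2minus) :
    ∃ δ₁ BC M₀ : ℝ, ∃ N₀ : ℕ, 0 < δ₁ ∧ 0 < BC ∧ 0 < M₀ ∧ 0 < N₀ ∧
      ∀ (k Mh R : ℕ), 3 ≤ Mh → M₀ ≤ ((ℓ : ℝ) + 1) * Mh → 2 * (ℓ + 1) ≤ R → N₀ + 1 ≤ R * ((ℓ + 1) * Mh) →
      ∀ (P : Fin (d + 1) → ℕ) (_hP : ∀ μ, 1 ≤ P μ) (_hP4 : ∀ μ, 4 ≤ P μ) (D : TDomains d ℓ Mh k P R) (a c : ℕ → ℝ),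
        (∀ i, 1 ≤ i → aminus ≤ a i ∧ a i ≤ aplus) → (∀ i, 1 ≤ i → a2minus ≤ c i ∧ c i ≤ a2plus) →
        (∀ i, 1 ≤ i → a (i + 1) = aNext ℓ (a i) (c i)) →
        ∀ (Q : Finset ↥(bset D.toDomains)) (js : ℕ), (∀ y ∈ Q, js ≤ y.1.1 ∧ y.1.1 ≤ js + 1) →
          (∀ y'' y', y'' ∉ Q → CkQT D a Q y'' y' = 0) ∧
          mulOp (indQ D.toDomains Q) * kerOp (W D.toDomains) (XkT D a) * mulOp (indQ D.toDomains Q) *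
              kerOp (W D.toDomains) (CkQT D a Q) = mulOp (indQ D.toDomains Q) ∧
          ∀ y ∈ Q, ∀ y' ∈ Q, |CkQT D a Q y y'| ≤
            BC / (((ℓ : ℝ) + 1) ^ js * 1) ^ (d + 1 + 4) * Real.exp (-(δ₁ * (geomT D).dist y y')) := by
  obtain ⟨δ₀, C, M₀, N₀, hδ₀, hC, hM₀, hN₀, h268⟩ :=
    ineq268_multiLevelTorus d ℓ hℓ aminus aplus a2minus a2plus ha ha2
  have hL0 : (0 : ℝ) < (ℓ : ℝ) + 1 := by positivity
  have hL1 : (1 : ℝ) ≤ (ℓ : ℝ) + 1 := by linarith [(Nat.cast_nonneg ℓ : (0 : ℝ) ≤ ℓ)]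
  have hlog : Real.log ((ℓ : ℝ) + 1) ≤ (ℓ : ℝ) + 1 := (Real.log_le_sub_one_of_pos hL0).trans (by linarith)
  have hlog0 : 0 ≤ Real.log ((ℓ : ℝ) + 1) := Real.log_nonneg hL1
  -- a positive upper weight (the window may be empty): `A = max a₊ a₋`
  obtain ⟨A, hAdef⟩ : ∃ A : ℝ, A = max aplus aminus := ⟨_, rfl⟩
  have hA0 : 0 < A := by rw [hAdef]; exact lt_of_lt_of_le ha (le_max_right _ _)
  -- the (2.59)-type threshold for Lemma 2.1 on the torus at `α = 1/16`
  obtain ⟨N₁, hN₁⟩ : ∃ N₁ : ℕ, N₁ = ⌈64 * ((d : ℝ) + 1) * ((ℓ : ℝ) + 1) / δ₀⌉₊ + 1 := ⟨_, rfl⟩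
  have hN₁pos : 0 < N₁ := by rw [hN₁]; omega
  have hN₁ge : 64 * ((d : ℝ) + 1) * ((ℓ : ℝ) + 1) < δ₀ * (N₁ : ℝ) := by
    have h : 64 * ((d : ℝ) + 1) * ((ℓ : ℝ) + 1) / δ₀ < (N₁ : ℝ) := by
      rw [hN₁]; push_cast; exact lt_of_le_of_lt (Nat.le_ceil _) (by linarith)
    rw [div_lt_iff₀ hδ₀] at h; linarith
  have hθ16 : Real.exp (-(1 / 16 * δ₀)) * ((ℓ : ℝ) + 1) ^ ((2 * (d + 1 : ℕ) : ℝ) / N₁) < 1 := by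
    refine theta_lt_one_of_log hL0 hN₁pos ?_
    push_cast
    have hd0 : (0 : ℝ) ≤ 2 * ((d : ℝ) + 1) := by positivity
    nlinarith [mul_le_mul_of_nonneg_left hlog hd0]
  -- the absorption threshold `L^{d+3} ≤ e^{(δ₀/8)(RM − 1)}`
  obtain ⟨N₂, hN₂⟩ : ∃ N₂ : ℕ, N₂ = ⌈8 * ((d : ℝ) + 3) * ((ℓ : ℝ) + 1) / δ₀⌉₊ := ⟨_, rfl⟩
  have hN₂ge : 8 * ((d : ℝ) + 3) * ((ℓ : ℝ) + 1) ≤ δ₀ * (N₂ : ℝ) := by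
    have h : 8 * ((d : ℝ) + 3) * ((ℓ : ℝ) + 1) / δ₀ ≤ (N₂ : ℝ) := by rw [hN₂]; exact Nat.le_ceil _
    rw [div_le_iff₀ hδ₀] at h; linarith
  -- constants
  obtain ⟨cK, hcK⟩ : ∃ cK : ℝ, cK = K261 N₁ (d + 1) ((ℓ : ℝ) + 1) 1 (1 / 16 * δ₀) := ⟨_, rfl⟩
  have hcK0 : 0 ≤ cK := by rw [hcK]; exact K261_nonneg (by positivity) zero_le_one
  obtain ⟨γB, hγB⟩ : ∃ γB : ℝ, γB = (C4 d A)⁻¹ := ⟨_, rfl⟩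
  have hγB0 : 0 < γB := by rw [hγB]; exact inv_pos.2 (C4_pos d A)
  obtain ⟨c₀, hc₀⟩ : ∃ c₀ : ℝ, c₀ = C * ((ℓ : ℝ) + 1) ^ (d + 3) := ⟨_, rfl⟩
  have hc₀0 : 0 ≤ c₀ := by rw [hc₀]; positivity
  obtain ⟨δ₁, hδ₁⟩ : ∃ δ₁ : ℝ, δ₁ = rate (fun _ => cK) γB c₀ (δ₀ / 8) := ⟨_, rfl⟩
  have hδ₁0 : 0 < δ₁ := by
    rw [hδ₁]; exact rate_pos (K := fun _ => cK) (fun _ _ => hcK0) hγB0 hc₀0 (by positivity)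
  refine ⟨δ₁, 2 / γB, M₀, max N₀ (max N₁ N₂), hδ₁0, by positivity, hM₀,
    lt_of_lt_of_le hN₀ (le_max_left _ _), ?_⟩
  intro k Mh R hMh hM hR hRM P hP hP4 D a c haw hcw hac Q js hQ
  have hMh1 : 1 ≤ Mh := le_trans (by norm_num) hMh
  have hRM0 : N₀ + 1 ≤ R * ((ℓ + 1) * Mh) := le_trans (Nat.succ_le_succ (le_max_left _ _)) hRM
  have hRM1 : N₁ + 1 ≤ R * ((ℓ + 1) * Mh) :=
    le_trans (Nat.succ_le_succ ((le_max_left _ _).trans (le_max_right _ _))) hRM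
  have hRM2 : N₂ + 1 ≤ R * ((ℓ + 1) * Mh) :=
    le_trans (Nat.succ_le_succ ((le_max_right _ _).trans (le_max_right _ _))) hRM
  have hRMone : 1 ≤ R * ((ℓ + 1) * Mh) := le_trans (by omega) hRM1
  have ha' : ∀ j, 1 ≤ j → 0 < a j := fun j hj => lt_of_lt_of_le ha (haw j hj).1
  have hale : ∀ j, 1 ≤ j → a j ≤ A := fun j hj => (haw j hj).2.trans (by rw [hAdef]; exact le_max_left _ _)
  -- (2.68)_T, Lemma 2.1 on the torus at 1/16, the absorption threshold
  have hX : ∀ y y', |XkT D a y y'| ≤ C * (geomT D).len y ^ 4 * ((geomT D).len y' ^ (d + 1))⁻¹ *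
      Real.exp (-(δ₀ / 4 * (geomT D).dist y y')) :=
    fun y y' => (h268 k Mh R hMh hM hR hRM0 P hP hP4 D a c haw hcw hac y y').1
  obtain ⟨-, h261, -, -⟩ := lemma21_torus D hMh1 hP hN₁pos hRM1 hδ₀.le (α := 1 / 16) (by norm_num) (by norm_num) hθ16
  have h261' : Ineq261With cK (geomT D) δ₀ (1 / 16) := by rw [hcK]; exact fun z => h261 z
  have hsmall : ((ℓ : ℝ) + 1) ^ (d + 3) * Real.exp (-(δ₀ / 8 * ((R : ℝ) * (((ℓ : ℝ) + 1) * Mh) - 1))) ≤ 1 := by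
    have hge : (N₂ : ℝ) ≤ (R : ℝ) * (((ℓ : ℝ) + 1) * Mh) - 1 := by
      have : ((N₂ + 1 : ℕ) : ℝ) ≤ ((R * ((ℓ + 1) * Mh) : ℕ) : ℝ) := by exact_mod_cast hRM2
      push_cast at this; linarith
    have hd3 : (0 : ℝ) ≤ (d : ℝ) + 3 := by positivity
    have e1 : ((d : ℝ) + 3) * Real.log ((ℓ : ℝ) + 1) ≤ ((d : ℝ) + 3) * ((ℓ : ℝ) + 1) :=
      mul_le_mul_of_nonneg_left hlog hd3
    have e2 : δ₀ * (N₂ : ℝ) ≤ δ₀ * ((R : ℝ) * (((ℓ : ℝ) + 1) * Mh) - 1) := mul_le_mul_of_nonneg_left hge hδ₀.le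
    have h1 : ((d : ℝ) + 3) * Real.log ((ℓ : ℝ) + 1) ≤ δ₀ / 8 * ((R : ℝ) * (((ℓ : ℝ) + 1) * Mh) - 1) := by
      linarith
    have h2 : ((ℓ : ℝ) + 1) ^ (d + 3) = Real.exp (((d : ℝ) + 3) * Real.log ((ℓ : ℝ) + 1)) := by
      rw [← Real.exp_log (pow_pos hL0 (d + 3)), Real.log_pow]; push_cast; ring_nf
    rw [h2, ← Real.exp_add, Real.exp_le_one_iff]
    linarith
  have hU := isUnit_BQT D a hℓ hMh1 hP ha' hale Q
  refine ⟨fun y'' y' h => CkQT_off (Or.inl h), loc_mul_CkQT D a Q hU, fun y hy y' hy' => ?_⟩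
  have h := CkQT_decay D a Q hℓ hMh1 hP hRMone ha' hale hC.le hδ₀ hcK0 hX hsmall h261' js hQ hy hy'
  rw [rate_Kprof, ← hγB, ← hc₀, ← hδ₁] at h
  exact h

end Package

end

end Literature.MathematicalPhysics.QuantumFieldTheory.Balaban1983to89.B6Ineq281MultiLevelTorus
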